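import Summits.QuantumFields.BalabanUV.Gaps.D1PinnedFirstOrderBilinear
import Summits.QuantumFields.BalabanUV.Gaps.D1PinnedFirstOrderQuadratic

/-!
# D1 (pinned family) — the K = 3 one-level path engine: an2's second-order letters over the affine-quadratic pair path `x(t) = (t²A + tB + C, t²P + tQ + R)`

Census row 79 (item (v), file 2 of 4); generalises `D1PinnedFirstOrderBilinear` §6 (the quadratic path `(t²A + tB, t²P + tQ)` of a colour RAY) to affine LINES of colour triples.  CONTENT (all
[folklore]; 0 def, 0 sorry): `common_bound₆`, **`dM_path₃`** (`dM K N x(t) b = t²•dM A P b + t•dM B Q b + dM C R b`), **`K2OfK_path₃`**, `prod_add_left ∕ _right`, `prod_path₃`,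
**`dM_K2OfK_path₃`** (`D(x(t)) = t⁴•D_AA + t³•(D_AB + D_BA) + t²•(D_AC + D_BB + D_CA) + t•(D_BC + D_CB) + D_CC`), **`K3OfK_pure_path₃`** (the `W`-free part of `K3OfK` over `x(t)`: all five
degrees), **`W2SymOfK_path₃`** (`W2SymOfK K N x(t) S₂ M₂ b b′ = W2SymOfK K N 0 0 S₂ M₂ b b′ + ½•[t⁴•E₄ + t³•E₃ + t²•E₂ + t•E₁ + E₀]`).  Imports `D1PinnedFirstOrderBilinear` (p379974 ✓) and
`D1PinnedFirstOrderQuadratic` ✓ (both with farm oleans).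

Provenance: cell pub-balaban-gaps, seat g1-p1 GEN 12 (prover-pub-balaban-gaps-g1-p1-g12-0), 2026-08-24.  HONEST FRAMING: [folklore] kernel algebra BY NAME over tree theorems;
NOTHING of Bałaban's asserted ([Balaban1987RG1] Thm 2 is UNPROVED IN PRINT); NO coefficient computed or signed; binder (D1) of B12 Thm 2 at the β-lead's pinned literal is NOT
discharged; NOT `BetaPertH`, NOT continuum, NOT Clay.
-/

noncomputable section

open Finset
open scoped BigOperators
open Literature.MathematicalPhysics.QuantumFieldTheory Balaban1983to89 Balaban1983to89.Beta
open ExpKernelCalculus (MKer Decays BiLoc VertexFamily comp)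
open OneStepResolventKernel (Fib LocStencil)
open SecondOrderResponse (dM K2OfK W2SymOfK W2OfK W2OfK_apply)
open BalabanStepW2 (K3OfK)
open Summit.QuantumFields.BalabanUV.Beta.TameKernelCalculus (Spr Loc comp_add_right_tame comp_add_left_tame)
open Summit.QuantumFields.BalabanUV.Beta.SecondOrderStepTransport (loc_K2OfK)
open Summit.QuantumFields.BalabanUV.Beta.SecondOrderTransport (K2OfK_eq dM_smul_kernel)
open InterLevelTransport (cwsum_apply)
open Summit.QuantumFields.BalabanUV.Beta.BubbleParity (spr_of_decays)
open Summit.QuantumFields.BalabanUV.Beta.SymCorrectorW2Gauge (decays_of_loc)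
open Summit.QuantumFields.BalabanUV.Gaps.D1PinnedFirstOrderBilinear (dM_add_pair sandwich_add dM_add_kernel bdd_of_locCert bdd_of_vfCert loc_dM_of_certs decays_K2OfK_of_certs dM_path K2OfK_path
  dM_K2OfK_path prod_add_add)
open Summit.QuantumFields.BalabanUV.Gaps.D1PinnedFirstOrderQuadratic (dM_scale K2OfK_scale)

namespace Summit.QuantumFields.BalabanUV.Gaps.D1PinnedFirstOrderPath3

variable {d : ℕ} {N : ℕ} [NeZero N] {K : MKer (d + 1) (Fib d)} {A B C P Q R : Fin (d + 1) → (Fin (d + 1) → ℤ) → MKer (d + 1) (Fib d)}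

omit [NeZero N] in
/-- [folklore] A common uniform bound for six certified tables. -/
theorem common_bound₆ (hA : ∃ C δ : ℝ, 0 < δ ∧ LocStencil A C δ) (hB : ∃ C δ : ℝ, 0 < δ ∧ LocStencil B C δ) (hC : ∃ C' δ : ℝ, 0 < δ ∧ LocStencil C C' δ)
    (hP : ∃ C δ : ℝ, 0 < δ ∧ VertexFamily P N C δ) (hQ : ∃ C δ : ℝ, 0 < δ ∧ VertexFamily Q N C δ) (hR : ∃ C δ : ℝ, 0 < δ ∧ VertexFamily R N C δ) :
    ∃ Bt : ℝ, (∀ κ u x z a b, |A κ u x z a b| ≤ Bt) ∧ (∀ κ u x z a b, |B κ u x z a b| ≤ Bt) ∧ (∀ κ u x z a b, |C κ u x z a b| ≤ Bt) ∧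
      (∀ ρ w x z a b, |P ρ w x z a b| ≤ Bt) ∧ (∀ ρ w x z a b, |Q ρ w x z a b| ≤ Bt) ∧ (∀ ρ w x z a b, |R ρ w x z a b| ≤ Bt) := by
  obtain ⟨B₁, h₁, hA⟩ := bdd_of_locCert hA; obtain ⟨B₂, h₂, hB⟩ := bdd_of_locCert hB; obtain ⟨B₃, h₃, hC⟩ := bdd_of_locCert hC
  obtain ⟨B₄, h₄, hP⟩ := bdd_of_vfCert (N := N) hP; obtain ⟨B₅, h₅, hQ⟩ := bdd_of_vfCert (N := N) hQ; obtain ⟨B₆, h₆, hR⟩ := bdd_of_vfCert (N := N) hR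
  exact ⟨B₁ + B₂ + B₃ + B₄ + B₅ + B₆, fun κ u x z a b => (hA κ u x z a b).trans (by linarith), fun κ u x z a b => (hB κ u x z a b).trans (by linarith),
    fun κ u x z a b => (hC κ u x z a b).trans (by linarith), fun ρ w x z a b => (hP ρ w x z a b).trans (by linarith), fun ρ w x z a b => (hQ ρ w x z a b).trans (by linarith),
    fun ρ w x z a b => (hR ρ w x z a b).trans (by linarith)⟩

/-- [folklore] Entrywise bound of a member of the quadratic path `t²A + tB` by `(t² + |t|)·Bt`. -/
private theorem abs_path_le {X Y : Fin (d + 1) → (Fin (d + 1) → ℤ) → MKer (d + 1) (Fib d)} {Bt : ℝ} (hX : ∀ κ u x z a b, |X κ u x z a b| ≤ Bt) (hY : ∀ κ u x z a b, |Y κ u x z a b| ≤ Bt)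
    (t : ℝ) (κ : Fin (d + 1)) (u x z : Fin (d + 1) → ℤ) (a b : Fib d) : |(t ^ 2 • X κ u + t • Y κ u) x z a b| ≤ (t ^ 2 + |t|) * Bt := by
  simp only [Pi.add_apply, Pi.smul_apply, smul_eq_mul]
  refine (abs_add_le _ _).trans ?_
  rw [abs_mul, abs_mul, abs_pow, sq_abs, add_mul]
  exact add_le_add (mul_le_mul_of_nonneg_left (hX κ u x z a b) (sq_nonneg t)) (mul_le_mul_of_nonneg_left (hY κ u x z a b) (abs_nonneg t))

/-- [folklore] **THE OPERATOR DERIVATIVE ALONG THE AFFINE-QUADRATIC PATH**: `dM K N (t²A + tB + C) (t²P + tQ + R) b = t²•dM K N A P b + t•dM K N B Q b + dM K N C R b`. -/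
theorem dM_path₃ (hK : ∃ δ C' : ℝ, 0 < δ ∧ 0 ≤ C' ∧ Decays K C' δ) (hA : ∃ C δ : ℝ, 0 < δ ∧ LocStencil A C δ) (hB : ∃ C δ : ℝ, 0 < δ ∧ LocStencil B C δ)
    (hC : ∃ C' δ : ℝ, 0 < δ ∧ LocStencil C C' δ) (hP : ∃ C δ : ℝ, 0 < δ ∧ VertexFamily P N C δ) (hQ : ∃ C δ : ℝ, 0 < δ ∧ VertexFamily Q N C δ)
    (hR : ∃ C δ : ℝ, 0 < δ ∧ VertexFamily R N C δ) (t : ℝ) (μ : Fin (d + 1)) (y : Fin (d + 1) → ℤ) :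
    dM K N (fun κ u => t ^ 2 • A κ u + t • B κ u + C κ u) (fun ρ w => t ^ 2 • P ρ w + t • Q ρ w + R ρ w) μ y =
      t ^ 2 • dM K N A P μ y + t • dM K N B Q μ y + dM K N C R μ y := by
  obtain ⟨Bt, hA', hB', hC', hP', hQ', hR'⟩ := common_bound₆ (N := N) hA hB hC hP hQ hR
  have hBt : 0 ≤ Bt := (abs_nonneg _).trans (hA' 0 0 0 0 (Sum.inl 0) (Sum.inl 0))
  have b1 : ∀ κ u x z a b, |(fun κ u => t ^ 2 • A κ u + t • B κ u) κ u x z a b| ≤ (t ^ 2 + |t| + 1) * Bt := fun κ u x z a b =>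
    (abs_path_le hA' hB' t κ u x z a b).trans (by nlinarith)
  have b2 : ∀ κ u x z a b, |C κ u x z a b| ≤ (t ^ 2 + |t| + 1) * Bt := fun κ u x z a b => (hC' κ u x z a b).trans (by nlinarith [sq_nonneg t, abs_nonneg t])
  have b3 : ∀ ρ w x z a b, |(fun ρ w => t ^ 2 • P ρ w + t • Q ρ w) ρ w x z a b| ≤ (t ^ 2 + |t| + 1) * Bt := fun ρ w x z a b =>
    (abs_path_le hP' hQ' t ρ w x z a b).trans (by nlinarith)
  have b4 : ∀ ρ w x z a b, |R ρ w x z a b| ≤ (t ^ 2 + |t| + 1) * Bt := fun ρ w x z a b => (hR' ρ w x z a b).trans (by nlinarith [sq_nonneg t, abs_nonneg t])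
  have e := dM_add_pair (N := N) hK b1 b2 b3 b4 μ y
  rw [dM_path hK hA' hB' hP' hQ' t μ y] at e
  rw [show (fun κ u => t ^ 2 • A κ u + t • B κ u + C κ u) = (fun κ u => t ^ 2 • A κ u + t • B κ u) + C from by funext κ u; simp [Pi.add_apply],
    show (fun ρ w => t ^ 2 • P ρ w + t • Q ρ w + R ρ w) = (fun ρ w => t ^ 2 • P ρ w + t • Q ρ w) + R from by funext ρ w; simp [Pi.add_apply], e]

/-- [folklore] **THE DERIVATIVE OF THE INVERSE ALONG THE AFFINE-QUADRATIC PATH**: `K2OfK K N x(t) b′ = t²•K2OfK K N A P b′ + t•K2OfK K N B Q b′ + K2OfK K N C R b′`. -/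
theorem K2OfK_path₃ (hK : ∃ δ C' : ℝ, 0 < δ ∧ 0 ≤ C' ∧ Decays K C' δ) (hA : ∃ C δ : ℝ, 0 < δ ∧ LocStencil A C δ) (hB : ∃ C δ : ℝ, 0 < δ ∧ LocStencil B C δ)
    (hC : ∃ C' δ : ℝ, 0 < δ ∧ LocStencil C C' δ) (hP : ∃ C δ : ℝ, 0 < δ ∧ VertexFamily P N C δ) (hQ : ∃ C δ : ℝ, 0 < δ ∧ VertexFamily Q N C δ)
    (hR : ∃ C δ : ℝ, 0 < δ ∧ VertexFamily R N C δ) (t : ℝ) (ν : Fin (d + 1)) (y' : Fin (d + 1) → ℤ) :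
    K2OfK K N (fun κ u => t ^ 2 • A κ u + t • B κ u + C κ u) (fun ρ w => t ^ 2 • P ρ w + t • Q ρ w + R ρ w) ν y' =
      t ^ 2 • K2OfK K N A P ν y' + t • K2OfK K N B Q ν y' + K2OfK K N C R ν y' := by
  have hKs : Spr K := spr_of_decays hK
  rw [K2OfK_eq, K2OfK_eq, K2OfK_eq, K2OfK_eq, dM_path₃ hK hA hB hC hP hQ hR t ν y',
    sandwich_add hKs (((loc_dM_of_certs hK hA hP ν y').smul _).add ((loc_dM_of_certs hK hB hQ ν y').smul _)) (loc_dM_of_certs hK hC hR ν y'),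
    sandwich_add hKs ((loc_dM_of_certs hK hA hP ν y').smul _) ((loc_dM_of_certs hK hB hQ ν y').smul _),
    KernelReflection.comp_smul_right, KernelReflection.comp_smul_left, KernelReflection.comp_smul_right, KernelReflection.comp_smul_left, neg_add, neg_add, smul_neg, smul_neg]

/-- [folklore] **THE CARRIER's FIRST-ORDER PART ALONG THE AFFINE-QUADRATIC PATH IS A FULL QUARTIC**: with `D_ac := dM (K2OfK K N a b′) N c b` over the three pairs `a, c ∈ {(A,P),(B,Q),(C,R)}`,
`dM (K2OfK K N x(t) b′) N x(t) b = t⁴•D_AA + t³•(D_AB + D_BA) + t²•(D_BB + D_AC + D_CA) + t•(D_BC + D_CB) + D_CC`. -/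
theorem dM_K2OfK_path₃ (hK : ∃ δ C' : ℝ, 0 < δ ∧ 0 ≤ C' ∧ Decays K C' δ) (hA : ∃ C δ : ℝ, 0 < δ ∧ LocStencil A C δ) (hB : ∃ C δ : ℝ, 0 < δ ∧ LocStencil B C δ)
    (hC : ∃ C' δ : ℝ, 0 < δ ∧ LocStencil C C' δ) (hP : ∃ C δ : ℝ, 0 < δ ∧ VertexFamily P N C δ) (hQ : ∃ C δ : ℝ, 0 < δ ∧ VertexFamily Q N C δ)
    (hR : ∃ C δ : ℝ, 0 < δ ∧ VertexFamily R N C δ) (t : ℝ) (μ : Fin (d + 1)) (y : Fin (d + 1) → ℤ) (ν : Fin (d + 1)) (y' : Fin (d + 1) → ℤ) :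
    dM (K2OfK K N (fun κ u => t ^ 2 • A κ u + t • B κ u + C κ u) (fun ρ w => t ^ 2 • P ρ w + t • Q ρ w + R ρ w) ν y') N
        (fun κ u => t ^ 2 • A κ u + t • B κ u + C κ u) (fun ρ w => t ^ 2 • P ρ w + t • Q ρ w + R ρ w) μ y =
      t ^ 4 • dM (K2OfK K N A P ν y') N A P μ y + t ^ 3 • (dM (K2OfK K N A P ν y') N B Q μ y + dM (K2OfK K N B Q ν y') N A P μ y) +
        t ^ 2 • (dM (K2OfK K N B Q ν y') N B Q μ y + dM (K2OfK K N A P ν y') N C R μ y + dM (K2OfK K N C R ν y') N A P μ y) +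
        t • (dM (K2OfK K N B Q ν y') N C R μ y + dM (K2OfK K N C R ν y') N B Q μ y) + dM (K2OfK K N C R ν y') N C R μ y := by
  obtain ⟨Bt, hA', hB', hC', hP', hQ', hR'⟩ := common_bound₆ (N := N) hA hB hC hP hQ hR
  have hKs : Spr K := spr_of_decays hK
  have hEa := decays_K2OfK_of_certs hK hA hP ν y'
  have hEb := decays_K2OfK_of_certs hK hB hQ ν y'
  have hEc := decays_K2OfK_of_certs hK hC hR ν y'
  -- the kernel slot: a weighted three-sum of decaying kernels
  have lA := loc_K2OfK hKs ν y' (loc_dM_of_certs hK hA hP ν y')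
  have lB := loc_K2OfK hKs ν y' (loc_dM_of_certs hK hB hQ ν y')
  have lC := loc_K2OfK hKs ν y' (loc_dM_of_certs hK hC hR ν y')
  have hE12 : ∃ δ C' : ℝ, 0 < δ ∧ 0 ≤ C' ∧ Decays (t ^ 2 • K2OfK K N A P ν y' + t • K2OfK K N B Q ν y') C' δ := decays_of_loc ((lA.smul _).add (lB.smul _))
  have hEa' : ∃ δ C' : ℝ, 0 < δ ∧ 0 ≤ C' ∧ Decays (t ^ 2 • K2OfK K N A P ν y') C' δ := decays_of_loc (lA.smul _)
  have hEb' : ∃ δ C' : ℝ, 0 < δ ∧ 0 ≤ C' ∧ Decays (t • K2OfK K N B Q ν y') C' δ := decays_of_loc (lB.smul _)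
  -- bounds of the two summands of the table path
  have b1 : ∀ κ u x z a b, |(fun κ u => t ^ 2 • A κ u + t • B κ u) κ u x z a b| ≤ (t ^ 2 + |t| + 1) * Bt := fun κ u x z a b =>
    (abs_path_le hA' hB' t κ u x z a b).trans (by nlinarith [(abs_nonneg _).trans (hA' 0 0 0 0 (Sum.inl 0) (Sum.inl 0))])
  have b2 : ∀ κ u x z a b, |C κ u x z a b| ≤ (t ^ 2 + |t| + 1) * Bt := fun κ u x z a b => (hC' κ u x z a b).trans (by nlinarith [sq_nonneg t, abs_nonneg t, (abs_nonneg _).trans (hA' 0 0 0 0 (Sum.inl 0) (Sum.inl 0))])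
  have b3 : ∀ ρ w x z a b, |(fun ρ w => t ^ 2 • P ρ w + t • Q ρ w) ρ w x z a b| ≤ (t ^ 2 + |t| + 1) * Bt := fun ρ w x z a b =>
    (abs_path_le hP' hQ' t ρ w x z a b).trans (by nlinarith [(abs_nonneg _).trans (hA' 0 0 0 0 (Sum.inl 0) (Sum.inl 0))])
  have b4 : ∀ ρ w x z a b, |R ρ w x z a b| ≤ (t ^ 2 + |t| + 1) * Bt := fun ρ w x z a b => (hR' ρ w x z a b).trans (by nlinarith [sq_nonneg t, abs_nonneg t, (abs_nonneg _).trans (hA' 0 0 0 0 (Sum.inl 0) (Sum.inl 0))])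
  -- split the table pair `(quadratic path) + (C,R)` in the table slot for each kernel, then the kernel slot
  have split : ∀ {X : MKer (d + 1) (Fib d)}, (∃ δ C' : ℝ, 0 < δ ∧ 0 ≤ C' ∧ Decays X C' δ) →
      dM X N (fun κ u => t ^ 2 • A κ u + t • B κ u + C κ u) (fun ρ w => t ^ 2 • P ρ w + t • Q ρ w + R ρ w) μ y =
        t ^ 2 • dM X N A P μ y + t • dM X N B Q μ y + dM X N C R μ y := fun hX => by
    have e := dM_add_pair (N := N) hX b1 b2 b3 b4 μ y
    rw [dM_path hX hA' hB' hP' hQ' t μ y] at e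
    rw [show (fun κ u => t ^ 2 • A κ u + t • B κ u + C κ u) = (fun κ u => t ^ 2 • A κ u + t • B κ u) + C from by funext κ u; simp [Pi.add_apply],
      show (fun ρ w => t ^ 2 • P ρ w + t • Q ρ w + R ρ w) = (fun ρ w => t ^ 2 • P ρ w + t • Q ρ w) + R from by funext ρ w; simp [Pi.add_apply], e]
  have bAll : ∀ κ u x z a b, |(fun κ u => t ^ 2 • A κ u + t • B κ u + C κ u) κ u x z a b| ≤ (t ^ 2 + |t| + 1) * Bt + (t ^ 2 + |t| + 1) * Bt := fun κ u x z a b =>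
    (abs_add_le _ _).trans (add_le_add (by simpa only [Pi.add_apply, Pi.smul_apply] using b1 κ u x z a b) (b2 κ u x z a b))
  have bAllM : ∀ ρ w x z a b, |(fun ρ w => t ^ 2 • P ρ w + t • Q ρ w + R ρ w) ρ w x z a b| ≤ (t ^ 2 + |t| + 1) * Bt + (t ^ 2 + |t| + 1) * Bt := fun ρ w x z a b => by
    exact (abs_add_le _ _).trans (add_le_add (by simpa only [Pi.add_apply, Pi.smul_apply] using b3 ρ w x z a b) (b4 ρ w x z a b))
  rw [K2OfK_path₃ hK hA hB hC hP hQ hR t ν y', dM_add_kernel hE12 hEc bAll bAllM, dM_add_kernel hEa' hEb' bAll bAllM, dM_smul_kernel, dM_smul_kernel,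
    split hEa, split hEb, split hEc]
  funext x z a b
  simp only [Pi.add_apply, Pi.smul_apply, smul_eq_mul]
  ring

/-- [folklore] `K ∘ (X₁ + X₂) ∘ Y` splits (tame compositions). -/
theorem prod_add_left {X₁ X₂ Y : MKer (d + 1) (Fib d)} (hKs : Spr K) (h₁ : Loc X₁) (h₂ : Loc X₂) (hY : Loc Y) :
    comp (comp K (X₁ + X₂)) Y = comp (comp K X₁) Y + comp (comp K X₂) Y := by
  rw [comp_add_right_tame hKs.tame h₁.tame h₂.tame, comp_add_left_tame (hKs.comp_loc h₁).tame (hKs.comp_loc h₂).tame hY.tame]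

/-- [folklore] `K ∘ X ∘ (Y₁ + Y₂)` splits (tame compositions). -/
theorem prod_add_right {X Y₁ Y₂ : MKer (d + 1) (Fib d)} (hKs : Spr K) (hX : Loc X) (h₁ : Loc Y₁) (h₂ : Loc Y₂) :
    comp (comp K X) (Y₁ + Y₂) = comp (comp K X) Y₁ + comp (comp K X) Y₂ := by
  rw [comp_add_right_tame (hKs.comp_loc hX).tame h₁.tame h₂.tame]

/-- [folklore] The product of two weighted three-sums of localised kernels through a spread `K`: nine weighted products. -/
theorem prod_path₃ {Da Db Dc Ea Eb Ec : MKer (d + 1) (Fib d)} (hKs : Spr K) (ha : Loc Da) (hb : Loc Db) (hc : Loc Dc) (ha' : Loc Ea) (hb' : Loc Eb) (hc' : Loc Ec) (t : ℝ) :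
    comp (comp K (t ^ 2 • Da + t • Db + Dc)) (t ^ 2 • Ea + t • Eb + Ec) =
      (t ^ 2 * t ^ 2) • comp (comp K Da) Ea + (t * t ^ 2) • comp (comp K Da) Eb + t ^ 2 • comp (comp K Da) Ec +
        ((t ^ 2 * t) • comp (comp K Db) Ea + (t * t) • comp (comp K Db) Eb + t • comp (comp K Db) Ec) +
        (t ^ 2 • comp (comp K Dc) Ea + t • comp (comp K Dc) Eb + comp (comp K Dc) Ec) := by
  have la := ha.smul (t ^ 2); have lb := hb.smul t; have la' := ha'.smul (t ^ 2); have lb' := hb'.smul t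
  rw [prod_add_left hKs (la.add lb) hc ((la'.add lb').add hc'), prod_add_left hKs la lb ((la'.add lb').add hc'),
    prod_add_right hKs la (la'.add lb') hc', prod_add_right hKs la la' lb', prod_add_right hKs lb (la'.add lb') hc', prod_add_right hKs lb la' lb',
    prod_add_right hKs hc (la'.add lb') hc', prod_add_right hKs hc la' lb']
  simp only [KernelReflection.comp_smul_right, KernelReflection.comp_smul_left, smul_smul]

/-- [folklore] **THE `W`-FREE PART OF THE THIRD-ORDER READ-OUT ALONG THE AFFINE-QUADRATIC PATH** (full quartic; `D_a := dM K N a`, `E_a := K2OfK K N a`, `a ∈ {(A,P),(B,Q),(C,R)}`):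
`K3OfK K N x(t) W b b′ + K∘W b b′∘K = −Σ_{a,c} t^{deg a + deg c} • (K∘D_a b∘E_c b′ + K∘D_a b′∘E_c b)`, `deg (A,P) = 2`, `deg (B,Q) = 1`, `deg (C,R) = 0`. -/
theorem K3OfK_pure_path₃ (hK : ∃ δ C' : ℝ, 0 < δ ∧ 0 ≤ C' ∧ Decays K C' δ) (hA : ∃ C δ : ℝ, 0 < δ ∧ LocStencil A C δ) (hB : ∃ C δ : ℝ, 0 < δ ∧ LocStencil B C δ)
    (hC : ∃ C' δ : ℝ, 0 < δ ∧ LocStencil C C' δ) (hP : ∃ C δ : ℝ, 0 < δ ∧ VertexFamily P N C δ) (hQ : ∃ C δ : ℝ, 0 < δ ∧ VertexFamily Q N C δ)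
    (hR : ∃ C δ : ℝ, 0 < δ ∧ VertexFamily R N C δ)
    (W : Fin (d + 1) → (Fin (d + 1) → ℤ) → Fin (d + 1) → (Fin (d + 1) → ℤ) → MKer (d + 1) (Fib d)) (t : ℝ) (μ : Fin (d + 1)) (y : Fin (d + 1) → ℤ) (ν : Fin (d + 1)) (y' : Fin (d + 1) → ℤ) :
    K3OfK K N (fun κ u => t ^ 2 • A κ u + t • B κ u + C κ u) (fun ρ w => t ^ 2 • P ρ w + t • Q ρ w + R ρ w) W μ y ν y' + comp (comp K (W μ y ν y')) K =
      -(t ^ 4 • (comp (comp K (dM K N A P μ y)) (K2OfK K N A P ν y') +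
            comp (comp K (dM K N A P ν y')) (K2OfK K N A P μ y)) +
        t ^ 3 • (comp (comp K (dM K N A P μ y)) (K2OfK K N B Q ν y') +
            comp (comp K (dM K N A P ν y')) (K2OfK K N B Q μ y) +
            comp (comp K (dM K N B Q μ y)) (K2OfK K N A P ν y') +
            comp (comp K (dM K N B Q ν y')) (K2OfK K N A P μ y)) +
        t ^ 2 • (comp (comp K (dM K N A P μ y)) (K2OfK K N C R ν y') +
            comp (comp K (dM K N A P ν y')) (K2OfK K N C R μ y) +
            comp (comp K (dM K N B Q μ y)) (K2OfK K N B Q ν y') +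
            comp (comp K (dM K N B Q ν y')) (K2OfK K N B Q μ y) +
            comp (comp K (dM K N C R μ y)) (K2OfK K N A P ν y') +
            comp (comp K (dM K N C R ν y')) (K2OfK K N A P μ y)) +
        t • (comp (comp K (dM K N B Q μ y)) (K2OfK K N C R ν y') +
            comp (comp K (dM K N B Q ν y')) (K2OfK K N C R μ y) +
            comp (comp K (dM K N C R μ y)) (K2OfK K N B Q ν y') +
            comp (comp K (dM K N C R ν y')) (K2OfK K N B Q μ y)) +
        (comp (comp K (dM K N C R μ y)) (K2OfK K N C R ν y') +
            comp (comp K (dM K N C R ν y')) (K2OfK K N C R μ y))) := by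
  have hKs : Spr K := spr_of_decays hK
  have hDa := loc_dM_of_certs hK hA hP
  have hDb := loc_dM_of_certs hK hB hQ
  have hDc := loc_dM_of_certs hK hC hR
  have hEa : ∀ c z, Loc (K2OfK K N A P c z) := fun c z => loc_K2OfK hKs c z (hDa c z)
  have hEb : ∀ c z, Loc (K2OfK K N B Q c z) := fun c z => loc_K2OfK hKs c z (hDb c z)
  have hEc : ∀ c z, Loc (K2OfK K N C R c z) := fun c z => loc_K2OfK hKs c z (hDc c z)
  funext x z a b
  simp only [BalabanStepW2.K3OfK, Pi.add_apply, Pi.neg_apply, Pi.smul_apply, smul_eq_mul]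
  rw [dM_path₃ hK hA hB hC hP hQ hR t μ y, dM_path₃ hK hA hB hC hP hQ hR t ν y', K2OfK_path₃ hK hA hB hC hP hQ hR t μ y, K2OfK_path₃ hK hA hB hC hP hQ hR t ν y',
    prod_path₃ hKs (hDa μ y) (hDb μ y) (hDc μ y) (hEa ν y') (hEb ν y') (hEc ν y') t, prod_path₃ hKs (hDa ν y') (hDb ν y') (hDc ν y') (hEa μ y) (hEb μ y) (hEc μ y) t]
  simp only [Pi.add_apply, Pi.smul_apply, smul_eq_mul]
  ring

/-- [folklore] **THE SYMMETRISED CARRIER ALONG THE AFFINE-QUADRATIC PATH**: `W2SymOfK K N x(t) S₂ M₂ b b′ = W2SymOfK K N 0 0 S₂ M₂ b b′ + ½ • [the full quartic of `dM_K2OfK_path₃` at `(b,b′)` and `(b′,b)`]`. -/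
theorem W2SymOfK_path₃ (hK : ∃ δ C' : ℝ, 0 < δ ∧ 0 ≤ C' ∧ Decays K C' δ) (hA : ∃ C δ : ℝ, 0 < δ ∧ LocStencil A C δ) (hB : ∃ C δ : ℝ, 0 < δ ∧ LocStencil B C δ)
    (hC : ∃ C' δ : ℝ, 0 < δ ∧ LocStencil C C' δ) (hP : ∃ C δ : ℝ, 0 < δ ∧ VertexFamily P N C δ) (hQ : ∃ C δ : ℝ, 0 < δ ∧ VertexFamily Q N C δ)
    (hR : ∃ C δ : ℝ, 0 < δ ∧ VertexFamily R N C δ)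
    (S₂ M₂ : Fin (d + 1) → (Fin (d + 1) → ℤ) → Fin (d + 1) → (Fin (d + 1) → ℤ) → MKer (d + 1) (Fib d)) (t : ℝ) (μ : Fin (d + 1)) (y : Fin (d + 1) → ℤ) (ν : Fin (d + 1)) (y' : Fin (d + 1) → ℤ) :
    W2SymOfK K N (fun κ u => t ^ 2 • A κ u + t • B κ u + C κ u) (fun ρ w => t ^ 2 • P ρ w + t • Q ρ w + R ρ w) S₂ M₂ μ y ν y' =
      W2SymOfK K N (fun _ _ => 0) (fun _ _ => 0) S₂ M₂ μ y ν y' +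
        (1 / 2 : ℝ) • (t ^ 4 • (dM (K2OfK K N A P ν y') N A P μ y +
            dM (K2OfK K N A P μ y) N A P ν y') +
          t ^ 3 • (dM (K2OfK K N A P ν y') N B Q μ y +
            dM (K2OfK K N A P μ y) N B Q ν y' +
            dM (K2OfK K N B Q ν y') N A P μ y +
            dM (K2OfK K N B Q μ y) N A P ν y') +
          t ^ 2 • (dM (K2OfK K N A P ν y') N C R μ y +
            dM (K2OfK K N A P μ y) N C R ν y' +
            dM (K2OfK K N B Q ν y') N B Q μ y +
            dM (K2OfK K N B Q μ y) N B Q ν y' +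
            dM (K2OfK K N C R ν y') N A P μ y +
            dM (K2OfK K N C R μ y) N A P ν y') +
          t • (dM (K2OfK K N B Q ν y') N C R μ y +
            dM (K2OfK K N B Q μ y) N C R ν y' +
            dM (K2OfK K N C R ν y') N B Q μ y +
            dM (K2OfK K N C R μ y) N B Q ν y') +
          (dM (K2OfK K N C R ν y') N C R μ y +
            dM (K2OfK K N C R μ y) N C R ν y')) := by
  have hz : ∀ (X : MKer (d + 1) (Fib d)) (c : Fin (d + 1)) (w : Fin (d + 1) → ℤ), dM X N (fun (_ : Fin (d + 1)) (_ : Fin (d + 1) → ℤ) => (0 : MKer (d + 1) (Fib d))) (fun _ _ => 0) c w = 0 := by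
    intro X c w
    funext x z a b
    simp [SecondOrderResponse.dM, OneStepKernelFamily.vertexOfK, SecondOrderResponse.vertexOfM, OneStepResolventKernel.wsum, cwsum_apply]
  simp only [SecondOrderResponse.W2SymOfK, W2OfK_apply]
  rw [dM_K2OfK_path₃ hK hA hB hC hP hQ hR t μ y ν y', dM_K2OfK_path₃ hK hA hB hC hP hQ hR t ν y' μ y, hz, hz]
  funext x z a b
  simp only [Pi.add_apply, Pi.smul_apply, Pi.zero_apply, smul_eq_mul]
  ring

end Summit.QuantumFields.BalabanUV.Gaps.D1PinnedFirstOrderPath3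

end
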